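import Mathlib
import Summits.Ventures.PercRepro2.Defs
import Summits.Ventures.PercRepro2.Graph
import Summits.Ventures.PercRepro2.Harris
import Summits.Ventures.PercRepro2.Events
import Summits.Ventures.PercRepro2.Independence
import Summits.Ventures.PercRepro2.Induced
import Summits.Ventures.PercRepro2.Exploration
import Summits.Ventures.PercRepro2.GateDefs
import Summits.Ventures.PercRepro2.GateAnatomy
import Summits.Ventures.PercRepro2.GateForest
import Summits.Ventures.PercRepro2.GateLSM
import Summits.Ventures.PercRepro2.HullTree
import Summits.Ventures.PercRepro2.GateFeedbackForest
import Summits.Ventures.PercRepro2.GateFeedback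
import Summits.Ventures.PercRepro2.GateFeedbackExit
import Summits.Ventures.PercRepro2.GateContract
import Summits.Ventures.PercRepro2.GateShadow
import Summits.Ventures.PercRepro2.GateSide
import Summits.Ventures.PercRepro2.GateSep
import Summits.Ventures.PercRepro2.SideCluster
import Summits.Ventures.PercRepro2.CactusDefs
import Summits.Ventures.PercRepro2.CactusTriangle
import Summits.Ventures.PercRepro2.CactusTriangleMass
import Summits.Ventures.PercRepro2.CactusCluster
import Summits.Ventures.PercRepro2.CactusDel
import Summits.Ventures.PercRepro2.CactusChain
import Summits.Ventures.PercRepro2.CactusKappa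
import Summits.Ventures.PercRepro2.CactusGate
import Summits.Ventures.PercRepro2.GateSupport

import Summits.Ventures.PercRepro2.CactusClosed
import Summits.Ventures.PercRepro2.CactusFilter

/-!
# THE ARTICULATION THEOREM: the cactus hypothesis is needed only on the root's region
(blind cell PercRepro2, mine-c g11; proofs/MINEC-FEEDBACK.md §9 (Theorem 3) and §15.4)

Let `C ∋ s` be a vertex set CLOSED between two vertices `am = a⁻, ap = a⁺ ∉ C`: every edge touching `C` has
its other end in `C ∪ {a⁻, a⁺}` (`C` is a union of components of `G − {a⁻, a⁺}`; the rest of `G` —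
other components between `a⁻` and `a⁺`, everything beyond them — is ARBITRARY). If `G[C]` and
`G[C ∪ {a⁻}]` are triangular cacti built from the root, the class-B mass of the instance
`(s, t := a⁺, u, w := a⁻)` is log-supermodular, hence the free one-sided gate holds
(`massBLogSupermod_of_articulation`, `gateRow_of_articulation`; the mirror image with
`G[C ∪ {a⁺}]` a cactus by the `(t, w)`-symmetry). Proof through the SUPPORT-CHAIN THEOREM:
every cluster of nonzero class-B mass lies in `C` (`subset_of_clusterEvent`); on such clusters the
cluster law of `G` is the cluster law of `G[C]` times the closed-edge factor of the edges from the
cluster to `{a⁻, a⁺}` (`prob_clusterEvent_eq_massOn_closed`, modular `tauA_mul`), log-supermodular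
by `Cactus.massOn_lsm`; and the components of `a⁻` in `G − a⁺ − W` meet `C` exactly in the
components of `a⁻` in `G[C ∪ {a⁻}] − W` (`conn_within_of_conn_delCfg`), which are nested by the
chain lemma on the cactus `G[C ∪ {a⁻}]`. With g10's separator moves and near-region reduction this
is Theorem 3 of the paper (the articulation reduction) in the kernel.
-/

namespace Summit.Ventures.PercRepro2

namespace CactusGate

open Cactus CactusChain GateSide

open scoped Classical

variable {V : Type*} {E : Type*} [Fintype E] [Fintype V]
variable {R : Type*} [Field R] [LinearOrder R] [IsStrictOrderedRing R]
variable {ends : E → Sym2 V}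

/-! ## Reachability from `am` avoiding `ap` stays in `G[C ∪ {am}]` inside `C` -/

omit [Fintype E] [Fintype V] in
/-- A connection from `am` in `G − ap − W` to a vertex of `C` is a connection in
`G[C ∪ {am}] − W`. -/
lemma conn_within_of_conn_delCfg {C : Set V} {am ap : V}
    (hC : ∀ e, ∀ x ∈ ends e, x ∈ C → ∀ y ∈ ends e, y ∈ C ∨ y = am ∨ y = ap)
    (hm : am ∉ C) {W : Set V} {y : V} (hy : y ∈ C)
    (h : Conn ends (delCfg ends (GateFeedback.Ft ends ap) W) am y) :
    Conn ends (delCfg ends (within ends (C ∪ {am})) W) am y := by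
  have key : y ∈ {v | v ∈ C → Conn ends (delCfg ends (within ends (C ∪ {am})) W) am v} := by
    refine mem_of_conn_of_closed (ends := ends) (ω := delCfg ends (GateFeedback.Ft ends ap) W) ?_
      (fun hc => (hm hc).elim) h
    intro v hv v' hvv' hv'C
    obtain ⟨_, e, heF, heW, hends⟩ := adj_delCfg_iff.1 hvv'
    have hea : ap ∉ ends e := heF
    rcases hC e v' (by rw [hends]; exact Sym2.mem_mk_right _ _) hv'C v
      (by rw [hends]; exact Sym2.mem_mk_left _ _) with hvC | hvm | hvp
    · refine conn_trans (hv hvC) (conn_delCfg_of_edge ?_ heW hends)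
      exact ⟨v, Or.inl hvC, v', Or.inl hv'C, hends⟩
    · subst hvm
      refine conn_delCfg_of_edge ?_ heW hends
      exact ⟨v, Or.inr rfl, v', Or.inl hv'C, hends⟩
    · exact (hea (by rw [hends, hvp]; exact Sym2.mem_mk_left _ _)).elim
  exact key hy

omit [Fintype E] [Fintype V] in
/-- A cluster `W ⊆ C` of `G` is the cluster of the same configuration in `G[C ∪ {am}]`. -/
lemma clusterOn_within_eq {C : Set V} {am s : V} {W : Finset V} (hW : (↑W : Set V) ⊆ C)
    {ω : Config E} (h : cluster ends ω s = ↑W) :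
    clusterOn ends (within ends (C ∪ {am})) ω s = ↑W := by
  unfold clusterOn
  apply Set.Subset.antisymm
  · rw [← h]; exact cluster_mono (restrict_le _ _) s
  · intro x hx
    have hxc : x ∈ cluster ends ω s := by rw [h]; exact hx
    have key : x ∈ {v | v ∈ W → Conn ends (restrict (within ends (C ∪ {am})) ω) s v} := by
      refine mem_of_conn_of_closed (ends := ends) (ω := ω) ?_ (fun _ => conn_refl _ _ _) hxc
      intro v hv v' hvv' hv'W
      have hv'c : v' ∈ cluster ends ω s := by rw [h]; exact Finset.mem_coe.2 hv'W
      have hvc : v ∈ cluster ends ω s := mem_cluster_of_adj hv'c hvv'.symm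
      have hvW : v ∈ W := by rw [h] at hvc; exact Finset.mem_coe.1 hvc
      obtain ⟨_, e, he, hends⟩ := openGraph_adj.1 hvv'
      refine conn_trans (hv hvW) (conn_of_openAdj ⟨e, restrict_eq_true_iff.2 ⟨he, ?_⟩, hends⟩)
      exact ⟨v, Or.inl (hW (Finset.mem_coe.2 hvW)), v', Or.inl (hW (Finset.mem_coe.2 hv'W)), hends⟩
    exact key (Finset.mem_coe.1 hx)

/-! ## The theorem -/

/-- **THE ARTICULATION THEOREM (FKG form).** `C ∋ s` closed between `am, ap ∉ C`; `G[C]` and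
`G[C ∪ {am}]` triangular cacti built from the root ⟹ the class-B mass of `(s, ap, u, am)` is
log-supermodular. -/
theorem massBLogSupermod_of_articulation {p : E → R} (hp : IsProbVec p) {s u : V} {C : Set V}
    {am ap : V} (hs : s ∈ C) (hm : am ∉ C) (hpl : ap ∉ C) (hne : am ≠ ap)
    (hC : ∀ e, ∀ x ∈ ends e, x ∈ C → ∀ y ∈ ends e, y ∈ C ∨ y = am ∨ y = ap)
    (hF : IsCactusFrom ends s (within ends C))
    (hF' : IsCactusFrom ends s (within ends (C ∪ {am}))) :
    GateLSM.MassBLogSupermod p ends s ap u am := by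
  -- clusters of nonzero class-B mass lie in `C`
  have hsub : ∀ W : Finset V, GateLSM.massB p ends s ap u am W ≠ 0 →
      (↑W : Set V) ⊆ C ∧ ∃ ω : Config E, cluster ends ω s = ↑W := by
    intro W hz
    obtain ⟨hpl', _, hm'⟩ := GateSupport.notMem_of_massB_ne_zero hz
    have hz' : prob p (clusterEvent ends s (↑W : Set V) ∩ GateAnatomy.classB ends s ap u am) ≠ 0 := hz
    obtain ⟨ω, hω, _⟩ := GateFeedback.nonempty_of_prob_ne_zero hz'
    have hω' : cluster ends ω s = ↑W := hω
    refine ⟨?_, ω, hω'⟩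
    rw [← hω']
    exact cluster_subset_of_closed hs hC (by rw [hω']; exact fun h => hm' (Finset.mem_coe.1 h))
      (by rw [hω']; exact fun h => hpl' (Finset.mem_coe.1 h))
  refine GateSupport.massBLogSupermod_of_support hp hne ?_ ?_
  · -- (a) the cluster law on support pairs
    intro W₁ W₂ hz₁ hz₂
    obtain ⟨hW₁, -⟩ := hsub W₁ hz₁
    obtain ⟨hW₂, -⟩ := hsub W₂ hz₂
    have hWI : (↑(W₁ ∩ W₂) : Set V) ⊆ C := by
      rw [Finset.coe_inter]; exact Set.inter_subset_left.trans hW₁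
    have hWU : (↑(W₁ ∪ W₂) : Set V) ⊆ C := by
      rw [Finset.coe_union]; exact Set.union_subset hW₁ hW₂
    rw [prob_clusterEvent_eq_massOn_closed p hC hm hpl hW₁,
      prob_clusterEvent_eq_massOn_closed p hC hm hpl hW₂,
      prob_clusterEvent_eq_massOn_closed p hC hm hpl hWI,
      prob_clusterEvent_eq_massOn_closed p hC hm hpl hWU]
    have hA := Cactus.massOn_lsm hp hF W₁ W₂
    have hB := tauA_mul (ends := ends) p hm hpl hW₁ hW₂
    have hν0 : ∀ W, 0 ≤ massOn p ends (within ends C) s W := fun W => prob_nonneg hp _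
    have hτ0 : ∀ W, 0 ≤ tauA p ends am ap W := fun W => tauA_nonneg hp am ap W
    calc massOn p ends (within ends C) s W₁ * tauA p ends am ap W₁ *
          (massOn p ends (within ends C) s W₂ * tauA p ends am ap W₂)
        = (massOn p ends (within ends C) s W₁ * massOn p ends (within ends C) s W₂) *
          (tauA p ends am ap W₁ * tauA p ends am ap W₂) := by ring
      _ ≤ (massOn p ends (within ends C) s (W₁ ∩ W₂) * massOn p ends (within ends C) s (W₁ ∪ W₂)) *
          (tauA p ends am ap (W₁ ∩ W₂) * tauA p ends am ap (W₁ ∪ W₂)) := by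
          rw [← hB]
          exact mul_le_mul_of_nonneg_right hA (mul_nonneg (hτ0 _) (hτ0 _))
      _ = _ := by ring
  · -- (b) the exit components are nested: the chain lemma on the cactus `G[C ∪ {am}]`
    intro W₁ W₂ hz₁ hz₂
    obtain ⟨hW₁, ω₁, hω₁⟩ := hsub W₁ hz₁
    obtain ⟨hW₂, ω₂, hω₂⟩ := hsub W₂ hz₂
    obtain ⟨_, _, hm₁⟩ := GateSupport.notMem_of_massB_ne_zero hz₁
    obtain ⟨_, _, hm₂⟩ := GateSupport.notMem_of_massB_ne_zero hz₂
    have h₁ := clusterOn_within_eq (am := am) hW₁ hω₁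
    have h₂ := clusterOn_within_eq (am := am) hW₂ hω₂
    by_cases hr : ∃ y ∈ W₂, Conn ends (delCfg ends (GateFeedback.Ft ends ap) (↑W₁ : Set V)) am y
    · refine Or.inr fun y hy hc => ?_
      refine CactusChain.chain hF' am ω₁ ω₂ ?_ ?_ ?_ ?_
      · rw [h₁]; exact fun h => hm₁ (Finset.mem_coe.1 h)
      · rw [h₂]; exact fun h => hm₂ (Finset.mem_coe.1 h)
      · rw [h₁, h₂]
        obtain ⟨y', hy', hc'⟩ := hr
        exact ⟨y', Finset.mem_coe.2 hy',
          conn_within_of_conn_delCfg hC hm (hW₂ (Finset.mem_coe.2 hy')) hc'⟩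
      · rw [h₁, h₂]
        exact ⟨y, Finset.mem_coe.2 hy,
          conn_within_of_conn_delCfg hC hm (hW₁ (Finset.mem_coe.2 hy)) hc⟩
    · exact Or.inl fun y hy hc => hr ⟨y, hy, hc⟩

/-- **THE ARTICULATION THEOREM.** The free one-sided gate `(s, t := ap, u, w := am)` holds whenever
the root's region `C` is closed between `am` and `ap` and `G[C]`, `G[C ∪ {am}]` are triangular
cacti — the rest of `G` is arbitrary. -/
theorem gateRow_of_articulation {p : E → R} (hp : IsProbVec p) (s a b u : V) {C : Set V}
    {am ap : V} (hs : s ∈ C) (hm : am ∉ C) (hpl : ap ∉ C) (hne : am ≠ ap)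
    (hC : ∀ e, ∀ x ∈ ends e, x ∈ C → ∀ y ∈ ends e, y ∈ C ∨ y = am ∨ y = ap)
    (hF : IsCactusFrom ends s (within ends C))
    (hF' : IsCactusFrom ends s (within ends (C ∪ {am}))) :
    Gate.GateRow p ends s {ap} a b {u} {am} :=
  GateSep.gateRow_of_massBLogSupermod hp s ap a b u am
    (massBLogSupermod_of_articulation hp hs hm hpl hne hC hF hF')

/-- **The mirror image**: `G[C ∪ {ap}]` a cactus (the side of the avoided vertex), by the
`(t, w)`-symmetry of the class-B mass. -/
theorem gateRow_of_articulation' {p : E → R} (hp : IsProbVec p) (s a b u : V) {C : Set V}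
    {am ap : V} (hs : s ∈ C) (hm : am ∉ C) (hpl : ap ∉ C) (hne : am ≠ ap)
    (hC : ∀ e, ∀ x ∈ ends e, x ∈ C → ∀ y ∈ ends e, y ∈ C ∨ y = am ∨ y = ap)
    (hF : IsCactusFrom ends s (within ends C))
    (hF' : IsCactusFrom ends s (within ends (C ∪ {ap}))) :
    Gate.GateRow p ends s {ap} a b {u} {am} := by
  have hC' : ∀ e, ∀ x ∈ ends e, x ∈ C → ∀ y ∈ ends e, y ∈ C ∨ y = ap ∨ y = am := by
    intro e x hx hxC y hy
    rcases hC e x hx hxC y hy with h | h | h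
    · exact Or.inl h
    · exact Or.inr (Or.inr h)
    · exact Or.inr (Or.inl h)
  exact GateSep.gateRow_of_massBLogSupermod hp s ap a b u am
    (GateSep.massBLogSupermod_comm
      (massBLogSupermod_of_articulation hp hs hpl hm hne.symm hC' hF hF'))

/-- **The articulation theorem with the paper's single hypothesis**: `G[C ∪ {am}]` a triangular
cactus built from the root (then so is `G[C]`, `Cactus.isCactusFrom_within_of_insert`). -/
theorem gateRow_of_articulation_single {p : E → R} (hp : IsProbVec p) (s a b u : V) {C : Set V}
    {am ap : V} (hs : s ∈ C) (hm : am ∉ C) (hpl : ap ∉ C) (hne : am ≠ ap)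
    (hC : ∀ e, ∀ x ∈ ends e, x ∈ C → ∀ y ∈ ends e, y ∈ C ∨ y = am ∨ y = ap)
    (hF' : IsCactusFrom ends s (within ends (C ∪ {am}))) :
    Gate.GateRow p ends s {ap} a b {u} {am} :=
  gateRow_of_articulation hp s a b u hs hm hpl hne hC
    (Cactus.isCactusFrom_within_of_insert hm hF') hF'

/-- The mirror image with the single hypothesis `G[C ∪ {ap}]` a triangular cactus. -/
theorem gateRow_of_articulation_single' {p : E → R} (hp : IsProbVec p) (s a b u : V) {C : Set V}
    {am ap : V} (hs : s ∈ C) (hm : am ∉ C) (hpl : ap ∉ C) (hne : am ≠ ap)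
    (hC : ∀ e, ∀ x ∈ ends e, x ∈ C → ∀ y ∈ ends e, y ∈ C ∨ y = am ∨ y = ap)
    (hF' : IsCactusFrom ends s (within ends (C ∪ {ap}))) :
    Gate.GateRow p ends s {ap} a b {u} {am} :=
  gateRow_of_articulation' hp s a b u hs hm hpl hne hC
    (Cactus.isCactusFrom_within_of_insert hpl hF') hF'

/-! ## Theorem 3 assembled: the moves to the articulation vertices -/

/-- **THEOREM 3 (the articulation reduction), assembled.** Let `am` separate the exit `w` from
the avoided vertex `t` and `ap` separate `t` from `am`, the root beyond neither; let the root's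
region `C` be closed between `am` and `ap` with `G[C ∪ {am}]` a triangular cactus built from the
root. Then the free one-sided gate holds — the rest of `G` (beyond `am`, beyond `ap`, and the other
components between them) is arbitrary. -/
theorem gateRow_of_articulation_moves {p : E → R} (hp : IsProbVec p) (s t a b u w : V)
    {C : Set V} {am ap : V} (hs : s ∈ C) (hm : am ∉ C) (hpl : ap ∉ C) (hne : am ≠ ap)
    (hC : ∀ e, ∀ x ∈ ends e, x ∈ C → ∀ y ∈ ends e, y ∈ C ∨ y = am ∨ y = ap)
    (hF' : IsCactusFrom ends s (within ends (C ∪ {am})))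
    (hsep₁ : w ∉ side ends am t) (hside₁ : w ∉ side ends am s) (hwam : w ≠ am) (htam : t ≠ am)
    (hsep₂ : t ∉ side ends ap am) (hside₂ : t ∉ side ends ap s) (htap : t ≠ ap) :
    Gate.GateRow p ends s {t} a b {u} {w} := by
  have h0 : GateLSM.MassBLogSupermod p ends s ap u am :=
    massBLogSupermod_of_articulation hp hs hm hpl hne hC
      (Cactus.isCactusFrom_within_of_insert hm hF') hF'
  have h1 : GateLSM.MassBLogSupermod p ends s t u am :=
    GateSep.massBLogSupermod_of_sep_avoid hp hsep₂ hside₂ htap hne h0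
  have h2 : GateLSM.MassBLogSupermod p ends s t u w :=
    GateSep.massBLogSupermod_of_sep_exit hp hsep₁ hside₁ hwam htam h1
  exact GateSep.gateRow_of_massBLogSupermod hp s t a b u w h2

/-- Theorem 3 with the exit already at the articulation vertex (`w = am`): only the avoided
vertex moves. -/
theorem gateRow_of_articulation_move_avoid {p : E → R} (hp : IsProbVec p) (s t a b u : V)
    {C : Set V} {am ap : V} (hs : s ∈ C) (hm : am ∉ C) (hpl : ap ∉ C) (hne : am ≠ ap)
    (hC : ∀ e, ∀ x ∈ ends e, x ∈ C → ∀ y ∈ ends e, y ∈ C ∨ y = am ∨ y = ap)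
    (hF' : IsCactusFrom ends s (within ends (C ∪ {am})))
    (hsep₂ : t ∉ side ends ap am) (hside₂ : t ∉ side ends ap s) (htap : t ≠ ap) :
    Gate.GateRow p ends s {t} a b {u} {am} := by
  have h0 : GateLSM.MassBLogSupermod p ends s ap u am :=
    massBLogSupermod_of_articulation hp hs hm hpl hne hC
      (Cactus.isCactusFrom_within_of_insert hm hF') hF'
  exact GateSep.gateRow_of_massBLogSupermod hp s t a b u am
    (GateSep.massBLogSupermod_of_sep_avoid hp hsep₂ hside₂ htap hne h0)

/-- Theorem 3 with the avoided vertex already at the articulation vertex (`t = ap`): only the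
exit moves. -/
theorem gateRow_of_articulation_move_exit {p : E → R} (hp : IsProbVec p) (s a b u w : V)
    {C : Set V} {am ap : V} (hs : s ∈ C) (hm : am ∉ C) (hpl : ap ∉ C) (hne : am ≠ ap)
    (hC : ∀ e, ∀ x ∈ ends e, x ∈ C → ∀ y ∈ ends e, y ∈ C ∨ y = am ∨ y = ap)
    (hF' : IsCactusFrom ends s (within ends (C ∪ {am})))
    (hsep₁ : w ∉ side ends am ap) (hside₁ : w ∉ side ends am s) (hwam : w ≠ am) :
    Gate.GateRow p ends s {ap} a b {u} {w} := by
  have h0 : GateLSM.MassBLogSupermod p ends s ap u am :=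
    massBLogSupermod_of_articulation hp hs hm hpl hne hC
      (Cactus.isCactusFrom_within_of_insert hm hF') hF'
  exact GateSep.gateRow_of_massBLogSupermod hp s ap a b u w
    (GateSep.massBLogSupermod_of_sep_exit hp hsep₁ hside₁ hwam hne.symm h0)

end CactusGate

end Summit.Ventures.PercRepro2
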